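import Summits.HubbardSuperconductivity.HubbardSuperconductivity.Theses.WeakCouplingBCS
import Literature.MathematicalPhysics.QuantumLattice.FinDimSpectrum

/-!
# Crux `WcbcsSsbToTorusLRO` (item `stmt-HubbardSuperconductivity-2009`): NEITHER Koma–Tasaki direction is abstract —
negative-side support from the standing disprover (generation 5), small-model facts, file 1 of 2

Both round-1 lines on this crux died at the same residue: modulo standard `T = 0` thermodynamic-limit items, the
ε-sharp Koma–Tasaki converse (SSB ⇒ pair LRO of EVERY finite-volume sector ground state). This file records, as
kernel-checked finite-dimensional counter-models (no definitions; the toy matrices are local notation), that nothing in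
the ABSTRACT structure those lines used — a `U(1)` charge `N` commuting with a Hermitian `H`, a pair operator `P`
lowering `N` by `2` with `P†P ≤ V²`, the variational principle, sourced energies `E(H - h(P + P†))` — decides either
direction of the Koma–Tasaki correspondence between sourced order and finite-volume ground-state long-range order:

* `not_abstractConverse` (`ℂ³`: `H = diag(0,1,1)`, `N = diag(0,0,2)`, `P = p|e₁⟩⟨e₂|`): the sourced chord is
  `≥ (24/25)hp - 1` (`ac_chord_ge`; with `p = mV`: sourced order density `≥ 12m/25` at every fixed field `h > 0` once
  the volume `V` is large, by the Griffiths sandwich), yet the source-free ground state `e₀` is unique (gap `1`) and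
  PAIR-INERT (`ac_groundState_pairInert`): an order-free competitor degenerate with the ordered pair-ladder in energy
  DENSITY is invisible to energy densities — the face-purity failure (Koma–Tasaki 1994 §0.7, Conjecture 10) in its
  smallest form; `ac_sourced_blind`: for `2hp ≤ 1` the sourced problem gains nothing at all (the deciding finite-volume
  data sit at mesoscopic fields `hV = O(1)`, discarded by the double limit `V → ∞` then `h → 0⁺`).
* (file 2 of 2, `AbstractForwardFalse.lean`) `not_abstractForward` (`ℂ²` family: `H_V = diag(0, V²)`, `N = diag(2,0)`, `P_V = V|e₁⟩⟨e₀|`): every ground state has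
  FULL pair order `⟨P†P⟩ = V²`, yet the sourced chord is `≤ 1` for all `h ≤ 1` uniformly in `V` (`af_chord_le_one`):
  Koma–Tasaki's forward theorem `m ≥ √2 o μ₂` needs the double-commutator (locality) budget of their Theorem 2.2
  (`Literature.MathematicalPhysics.QuantumLattice.KomaTasaki.horschVonDerLinden_holds`), which the toy violates
  (`⟨e₀, [[P+P†, H], P+P†] e₀⟩ = 2V⁴`).

Consequence for new lines: a lever that is a functional of sourced / quenched / block-repelled ENERGIES to leading
order in the volume cannot separate the Hubbard torus from `H ⊕ Y`-type competitors; an input is needed that is false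
for the `ℂ³` toy (energy scale `O(1)`, or locality of `P = Σ_x P_x` beyond `P†P ≤ V²`). Workfile:
`Cruxes/WcbcsSsbToTorusLRO/DisproofRound2.lean` §17 (index in `Cruxes/WcbcsSsbToTorusLRO/Disproof.lean`).
Elementary linear algebra. [folklore]
-/

noncomputable section

namespace Summit.HubbardSuperconductivity.WcbcsSsbToTorusLRO.Negative

open Matrix

/-- Converse toy Hamiltonian `diag(0, 1, 1)` on `ℂ³`. -/
local notation "acH" => (Matrix.diagonal ![(0 : ℂ), 1, 1] : Matrix (Fin 3) (Fin 3) ℂ)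
/-- Converse toy number operator `diag(0, 0, 2)`. -/
local notation "acN" => (Matrix.diagonal ![(0 : ℂ), 0, 2] : Matrix (Fin 3) (Fin 3) ℂ)
/-- Converse toy pair annihilator `p |e₁⟩⟨e₂|`. -/
local notation "acP[" p "]" =>
  (Matrix.of ![![(0 : ℂ), 0, 0], ![0, 0, ((p : ℝ) : ℂ)], ![0, 0, 0]] : Matrix (Fin 3) (Fin 3) ℂ)

/-! ### Variational bookkeeping (restated; five lines) -/

/-- `re ⟨ψ, A ψ⟩ ≥ -Σ_{s,t} |A_{st}|` for a unit vector. [folklore] -/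
theorem neg_sum_norm_le_rayleigh {n : Type*} [Fintype n] (A : Matrix n n ℂ) {ψ : n → ℂ} (hψ : star ψ ⬝ᵥ ψ = 1) :
    -(∑ s, ∑ t, ‖A s t‖) ≤ (star ψ ⬝ᵥ A *ᵥ ψ).re := by
  have hcomp : ∀ s, ‖ψ s‖ ≤ 1 := by
    intro s
    have h1 : ‖ψ s‖ ^ 2 ≤ ∑ t, ‖ψ t‖ ^ 2 :=
      Finset.single_le_sum (fun t _ => sq_nonneg (‖ψ t‖)) (Finset.mem_univ s)
    have h2 : (∑ t, ‖ψ t‖ ^ 2 : ℝ) = 1 := by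
      have := congrArg Complex.re hψ
      rw [dotProduct, Complex.re_sum] at this
      simp only [Pi.star_apply, Complex.star_def, Complex.conj_mul', Complex.one_re] at this
      rw [← this]
      refine Finset.sum_congr rfl fun t _ => ?_
      norm_cast
    rw [h2] at h1
    nlinarith [norm_nonneg (ψ s)]
  have hbound : ‖star ψ ⬝ᵥ A *ᵥ ψ‖ ≤ ∑ s, ∑ t, ‖A s t‖ := by
    rw [dotProduct]
    refine (norm_sum_le _ _).trans (Finset.sum_le_sum fun s _ => ?_)
    rw [Pi.star_apply, norm_mul, norm_star, Matrix.mulVec, dotProduct]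
    refine (mul_le_of_le_one_left (norm_nonneg _) (hcomp s)).trans ?_
    refine (norm_sum_le _ _).trans (Finset.sum_le_sum fun t _ => ?_)
    rw [norm_mul]
    exact mul_le_of_le_one_right (norm_nonneg _) (hcomp t)
  have := Complex.abs_re_le_norm (star ψ ⬝ᵥ A *ᵥ ψ)
  rw [abs_le] at this
  linarith [this.1]

/-- The Rayleigh set of `A` on unit vectors of `K` is bounded below. [folklore] -/
theorem bddBelow_rayleigh {n : Type*} [Fintype n] (A : Matrix n n ℂ) (K : Submodule ℂ (n → ℂ)) :
    BddBelow {E : ℝ | ∃ ψ ∈ K, star ψ ⬝ᵥ ψ = 1 ∧ E = (star ψ ⬝ᵥ A *ᵥ ψ).re} := by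
  refine ⟨-(∑ s, ∑ t, ‖A s t‖), ?_⟩
  rintro E ⟨ψ, -, hψ, rfl⟩
  exact neg_sum_norm_le_rayleigh A hψ

/-- Variational principle in a sector: `minEnergyOn A K ≤ re ⟨ψ, A ψ⟩` for unit `ψ ∈ K`. [folklore] -/
theorem minEnergyOn_le_rayleigh {n : Type*} [Fintype n] (A : Matrix n n ℂ) (K : Submodule ℂ (n → ℂ))
    {ψ : n → ℂ} (hψK : ψ ∈ K) (hψ : star ψ ⬝ᵥ ψ = 1) : A.minEnergyOn K ≤ (star ψ ⬝ᵥ A *ᵥ ψ).re :=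
  csInf_le (bddBelow_rayleigh A K) ⟨ψ, hψK, hψ, rfl⟩

/-! ### The converse direction -/

/-- Action of the converse toy Hamiltonian. [folklore] -/
theorem acH_mulVec (ψ : Fin 3 → ℂ) : acH *ᵥ ψ = ![0, ψ 1, ψ 2] := by
  ext i
  fin_cases i <;> simp [Matrix.mulVec_diagonal]

/-- Action of the converse toy pair annihilator. [folklore] -/
theorem acP_mulVec (p : ℝ) (ψ : Fin 3 → ℂ) : acP[p] *ᵥ ψ = ![0, (p : ℂ) * ψ 2, 0] := by
  ext i
  fin_cases i <;> simp [Matrix.mulVec, dotProduct, Fin.sum_univ_three]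

/-- Adjoint of the converse toy pair annihilator. [folklore] -/
theorem acP_conjTranspose (p : ℝ) :
    acP[p]ᴴ = Matrix.of ![![0, 0, 0], ![0, 0, 0], ![0, (p : ℂ), 0]] := by
  ext i j
  fin_cases i <;> fin_cases j <;> simp [Matrix.conjTranspose_apply]

/-- Action of the adjoint pair operator. [folklore] -/
theorem acPH_mulVec (p : ℝ) (ψ : Fin 3 → ℂ) : acP[p]ᴴ *ᵥ ψ = ![0, 0, (p : ℂ) * ψ 1] := by
  rw [acP_conjTranspose]
  ext i
  fin_cases i <;> simp [Matrix.mulVec, dotProduct, Fin.sum_univ_three]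

/-- Action of the pair intensity `P†P`. [folklore] -/
theorem acPHP_mulVec (p : ℝ) (ψ : Fin 3 → ℂ) :
    (acP[p]ᴴ * acP[p]) *ᵥ ψ = ![0, 0, (p : ℂ) * ((p : ℂ) * ψ 2)] := by
  rw [← Matrix.mulVec_mulVec, acP_mulVec, acPH_mulVec]
  ext i
  fin_cases i <;> simp

/-- The converse toy Hamiltonian is Hermitian. [folklore] -/
theorem acH_isHermitian : (acH).IsHermitian := by
  unfold Matrix.IsHermitian
  ext i j
  fin_cases i <;> fin_cases j <;> simp [Matrix.conjTranspose_apply, Matrix.diagonal]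

/-- The converse toy number operator is Hermitian. [folklore] -/
theorem acN_isHermitian : (acN).IsHermitian := by
  unfold Matrix.IsHermitian
  ext i j
  fin_cases i <;> fin_cases j <;> simp [Matrix.conjTranspose_apply, Matrix.diagonal]

/-- Number conservation `[H, N] = 0` in the converse toy. [folklore] -/
theorem acH_comm_acN : acH * acN = acN * acH := by
  simp [Matrix.diagonal_mul_diagonal, mul_comm]

/-- `P` lowers the number by two: `NP - PN = -2P` (converse toy). [folklore] -/
theorem acN_comm_acP (p : ℝ) : acN * acP[p] - acP[p] * acN = -((2 : ℂ) • acP[p]) := by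
  ext i j
  simp only [Matrix.sub_apply, Matrix.diagonal_mul, Matrix.mul_diagonal, Matrix.neg_apply,
    Matrix.smul_apply, smul_eq_mul]
  fin_cases i <;> fin_cases j <;> simp
  ring

/-- `re⟨ψ, H ψ⟩ = |ψ 1|² + |ψ 2|²`. [folklore] -/
theorem re_rayleigh_acH (ψ : Fin 3 → ℂ) : (star ψ ⬝ᵥ acH *ᵥ ψ).re = ‖ψ 1‖ ^ 2 + ‖ψ 2‖ ^ 2 := by
  rw [acH_mulVec, Complex.sq_norm, Complex.sq_norm, Complex.normSq_apply, Complex.normSq_apply]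
  simp [dotProduct, Fin.sum_univ_three, Complex.mul_re]

/-- `re⟨ψ, (P + Pᴴ) ψ⟩ = 2p·re(conj(ψ 1) ψ 2)`. [folklore] -/
theorem re_rayleigh_acSource (p : ℝ) (ψ : Fin 3 → ℂ) :
    (star ψ ⬝ᵥ (acP[p] + acP[p]ᴴ) *ᵥ ψ).re = 2 * p * ((starRingEnd ℂ) (ψ 1) * ψ 2).re := by
  rw [Matrix.add_mulVec, acP_mulVec, acPH_mulVec]
  simp [dotProduct, Fin.sum_univ_three, Complex.mul_re, Complex.mul_im]
  ring

/-- `re⟨ψ, P†P ψ⟩ = p² |ψ 2|²`. [folklore] -/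
theorem re_rayleigh_acPHP (p : ℝ) (ψ : Fin 3 → ℂ) :
    (star ψ ⬝ᵥ (acP[p]ᴴ * acP[p]) *ᵥ ψ).re = p ^ 2 * ‖ψ 2‖ ^ 2 := by
  rw [acPHP_mulVec, Complex.sq_norm, Complex.normSq_apply]
  simp [dotProduct, Fin.sum_univ_three, Complex.mul_re, Complex.mul_im]
  ring

/-- The sourced Rayleigh quotient. [folklore] -/
theorem re_rayleigh_acSourced (p h : ℝ) (ψ : Fin 3 → ℂ) :
    (star ψ ⬝ᵥ (acH - (h : ℂ) • (acP[p] + acP[p]ᴴ)) *ᵥ ψ).re =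
      ‖ψ 1‖ ^ 2 + ‖ψ 2‖ ^ 2 - 2 * h * p * ((starRingEnd ℂ) (ψ 1) * ψ 2).re := by
  rw [Matrix.sub_mulVec, dotProduct_sub, Complex.sub_re, Matrix.smul_mulVec, dotProduct_smul, smul_eq_mul,
    Complex.re_ofReal_mul, re_rayleigh_acH, re_rayleigh_acSource]
  ring

/-- `re ⟨ψ, ψ⟩ = Σ |ψ i|²` on `ℂ³`. [folklore] -/
theorem re_star_self (ψ : Fin 3 → ℂ) : (star ψ ⬝ᵥ ψ).re = ‖ψ 0‖ ^ 2 + ‖ψ 1‖ ^ 2 + ‖ψ 2‖ ^ 2 := by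
  rw [Complex.sq_norm, Complex.sq_norm, Complex.sq_norm, Complex.normSq_apply, Complex.normSq_apply,
    Complex.normSq_apply]
  simp [dotProduct, Fin.sum_univ_three, Complex.mul_re]

/-- Unit vectors of `ℂ³`. [folklore] -/
theorem ac_unit {ψ : Fin 3 → ℂ} (hψ : star ψ ⬝ᵥ ψ = 1) : ‖ψ 0‖ ^ 2 + ‖ψ 1‖ ^ 2 + ‖ψ 2‖ ^ 2 = 1 := by
  rw [← re_star_self, hψ, Complex.one_re]

/-- `E(H) = 0`. [folklore] -/
theorem minEnergyOn_acH : (acH).minEnergyOn ⊤ = 0 := by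
  apply le_antisymm
  · have h := minEnergyOn_le_rayleigh acH ⊤ (ψ := ![1, 0, 0]) Submodule.mem_top
      (by simp [dotProduct, Fin.sum_univ_three])
    rw [re_rayleigh_acH] at h
    simpa using h
  · refine le_csInf ⟨_, ![1, 0, 0], Submodule.mem_top, by simp [dotProduct, Fin.sum_univ_three], rfl⟩ ?_
    rintro E ⟨ψ, -, -, rfl⟩
    rw [re_rayleigh_acH]
    positivity

/-- `P†P ≤ p²`. [folklore] -/
theorem acPHP_le (p : ℝ) (φ : Fin 3 → ℂ) :
    (star φ ⬝ᵥ (acP[p]ᴴ * acP[p]) *ᵥ φ).re ≤ p ^ 2 * (star φ ⬝ᵥ φ).re := by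
  rw [re_rayleigh_acPHP, re_star_self]
  nlinarith [sq_nonneg ‖φ 0‖, sq_nonneg ‖φ 1‖, sq_nonneg p, mul_nonneg (sq_nonneg p) (sq_nonneg ‖φ 0‖),
    mul_nonneg (sq_nonneg p) (sq_nonneg ‖φ 1‖)]

/-- The real trial vector `(0, s, c)`. [folklore] -/
theorem rayleigh_trial (p h s c : ℝ) :
    (star ![(0 : ℂ), s, c] ⬝ᵥ (acH - (h : ℂ) • (acP[p] + acP[p]ᴴ)) *ᵥ ![(0 : ℂ), s, c]).re =
      s ^ 2 + c ^ 2 - 2 * h * p * (s * c) := by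
  rw [re_rayleigh_acSourced]
  simp [Complex.conj_ofReal, ← Complex.ofReal_mul, Complex.ofReal_re, Complex.norm_real, Real.norm_eq_abs, sq_abs]

/-- The real trial vector `(0, s, c)` with `s² + c² = 1` is a unit vector. [folklore] -/
theorem trial_unit {s c : ℝ} (hsc : s ^ 2 + c ^ 2 = 1) : star ![(0 : ℂ), s, c] ⬝ᵥ ![(0 : ℂ), s, c] = 1 := by
  apply Complex.ext
  · rw [re_star_self]
    simp [Complex.norm_real, Real.norm_eq_abs, sq_abs, hsc]
  · simp [dotProduct, Fin.sum_univ_three, Complex.mul_im, Complex.conj_ofReal]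

/-- **Sourced chord** (upper bound on the sourced energy through the unit trial vector `(0, 3/5, 4/5)`):
`E(H - h(P + Pᴴ)) ≤ 1 - (24/25)·h·p`. [folklore] -/
theorem minEnergyOn_acSourced_le (p h : ℝ) :
    (acH - (h : ℂ) • (acP[p] + acP[p]ᴴ)).minEnergyOn ⊤ ≤ 1 - 24 / 25 * (h * p) := by
  have hu : (3 / 5 : ℝ) ^ 2 + (4 / 5) ^ 2 = 1 := by norm_num
  have h1 := minEnergyOn_le_rayleigh (acH - (h : ℂ) • (acP[p] + acP[p]ᴴ)) ⊤ Submodule.mem_top (trial_unit hu)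
  rw [rayleigh_trial] at h1
  refine h1.trans (le_of_eq ?_)
  ring

/-- So the chord `E(H) - E(H - h(P+Pᴴ))` is at least `(24/25) h p - 1`: per unit "volume" `V = p/m` and field,
a sourced order density `≥ (12/25) m - 1/(2hV)`, positive for every fixed `h > 0` once `V` is large. [folklore] -/
theorem ac_chord_ge (p h : ℝ) :
    24 / 25 * (h * p) - 1 ≤ (acH).minEnergyOn ⊤ - (acH - (h : ℂ) • (acP[p] + acP[p]ᴴ)).minEnergyOn ⊤ := by
  rw [minEnergyOn_acH]
  have := minEnergyOn_acSourced_le p h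
  linarith

/-- **Every ground state of the source-free toy is pair-inert**: `Hψ = E(H)ψ`, `‖ψ‖ = 1 ⇒ ⟨ψ, P†P ψ⟩ = 0`. [folklore] -/
theorem ac_groundState_pairInert (p : ℝ) {ψ : Fin 3 → ℂ}
    (hGS : acH *ᵥ ψ = (((acH).minEnergyOn ⊤ : ℝ) : ℂ) • ψ) : (star ψ ⬝ᵥ (acP[p]ᴴ * acP[p]) *ᵥ ψ).re = 0 := by
  rw [minEnergyOn_acH, acH_mulVec] at hGS
  have h2 : ψ 2 = 0 := by
    have := congrFun hGS 2
    simpa using this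
  rw [re_rayleigh_acPHP, h2, norm_zero]
  ring

/-- **The ground state `Y = e₀` is a unit eigen-ground-state** of the source-free toy. [folklore] -/
theorem ac_groundState_Y : acH *ᵥ ![1, 0, 0] = (((acH).minEnergyOn ⊤ : ℝ) : ℂ) • ![1, 0, 0] := by
  rw [minEnergyOn_acH, acH_mulVec]
  simp

/-- **¬ AbstractConverse**: instantiate at the toy with `p = V = 4`, `a = 1/4`, `h = 1` (chord `≥ 71/25 ≥ 2 = 2haV`). [folklore] -/
theorem not_abstractConverse : ¬ (
  ∀ (n : Type) [Fintype n] [DecidableEq n] (H N P : Matrix n n ℂ) (V a h : ℝ),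
    H.IsHermitian → N.IsHermitian → H * N = N * H → N * P - P * N = -((2 : ℂ) • P) →
    0 < V → 0 < a → 0 < h →
    (∀ φ : n → ℂ, (star φ ⬝ᵥ (Pᴴ * P) *ᵥ φ).re ≤ V ^ 2 * (star φ ⬝ᵥ φ).re) →
    2 * h * a * V ≤ H.minEnergyOn ⊤ - (H - (h : ℂ) • (P + Pᴴ)).minEnergyOn ⊤ →
    ∀ ψ : n → ℂ, star ψ ⬝ᵥ ψ = 1 → H *ᵥ ψ = ((H.minEnergyOn ⊤ : ℝ) : ℂ) • ψ →
      0 < (star ψ ⬝ᵥ (Pᴴ * P) *ᵥ ψ).re) := by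
  intro hA
  have hchord : 2 * (1 : ℝ) * (1 / 4) * 4 ≤
      (acH).minEnergyOn ⊤ - (acH - ((1 : ℝ) : ℂ) • (acP[4] + acP[4]ᴴ)).minEnergyOn ⊤ := by
    have := ac_chord_ge 4 1
    linarith
  have hV : ∀ φ : Fin 3 → ℂ, (star φ ⬝ᵥ (acP[4]ᴴ * acP[4]) *ᵥ φ).re ≤ (4 : ℝ) ^ 2 * (star φ ⬝ᵥ φ).re :=
    acPHP_le 4
  have h := hA (Fin 3) acH acN acP[4] 4 (1 / 4) 1 acH_isHermitian acN_isHermitian acH_comm_acN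
    (acN_comm_acP 4) (by norm_num) (by norm_num) one_pos hV hchord ![1, 0, 0]
    (by simp [dotProduct, Fin.sum_univ_three]) ac_groundState_Y
  rw [ac_groundState_pairInert 4 ac_groundState_Y] at h
  exact lt_irrefl _ h

/-- **Blindness below the threshold field**: for `0 ≤ h ≤ 1/(2p)`... here with the crude constant: for
`2hp ≤ 1` the sourced toy gains NOTHING — `E(H - h(P+Pᴴ)) = 0 = E(H)` — the order-free competitor `Y` is the
sourced ground state as well. The finite-volume sourced energy sees the competition only at fields
`h ≳ ε/(mV)` ("mesoscopic" fields, invisible after `V → ∞` at fixed `h`). [folklore] -/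
theorem ac_sourced_blind {p h : ℝ} (hp : 0 ≤ p) (h0 : 0 ≤ h) (hh : 2 * h * p ≤ 1) :
    (acH - (h : ℂ) • (acP[p] + acP[p]ᴴ)).minEnergyOn ⊤ = 0 := by
  apply le_antisymm
  · have h1 := minEnergyOn_le_rayleigh (acH - (h : ℂ) • (acP[p] + acP[p]ᴴ)) ⊤ (ψ := ![1, 0, 0])
      Submodule.mem_top (by simp [dotProduct, Fin.sum_univ_three])
    rw [re_rayleigh_acSourced] at h1
    simpa using h1
  · refine le_csInf ⟨_, ![1, 0, 0], Submodule.mem_top, by simp [dotProduct, Fin.sum_univ_three], rfl⟩ ?_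
    rintro E ⟨ψ, -, hψ, rfl⟩
    rw [re_rayleigh_acSourced]
    have hre : ((starRingEnd ℂ) (ψ 1) * ψ 2).re ≤ ‖ψ 1‖ * ‖ψ 2‖ := by
      refine (Complex.re_le_norm _).trans (le_of_eq ?_)
      rw [norm_mul, RCLike.norm_conj]
    have hamgm : 2 * (‖ψ 1‖ * ‖ψ 2‖) ≤ ‖ψ 1‖ ^ 2 + ‖ψ 2‖ ^ 2 := by nlinarith [sq_nonneg (‖ψ 1‖ - ‖ψ 2‖)]
    have hhp : 0 ≤ h * p := mul_nonneg h0 hp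
    nlinarith [hre, hamgm, hhp, mul_nonneg hhp (mul_nonneg (norm_nonneg (ψ 1)) (norm_nonneg (ψ 2))),
      sq_nonneg ‖ψ 1‖, sq_nonneg ‖ψ 2‖]

end Summit.HubbardSuperconductivity.WcbcsSsbToTorusLRO.Negative

end
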